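import Summits.ResolutionOfSingularities.ResolutionOfSingularities.Theorems.FrobeniusClosingPatchingRelPerfectAtomicRoofEnginePhase
import HarnessLib

/-!
# Crux `PatchingRelPerfect` (stmt-ResolutionOfSingularities-16161), line `closed-point-slice` v4:
# stub `stub_atomicRoofEngine`, part 2 — Zariski–Piltant patching in every dimension, Temkin format

Route `ResolutionOfSingularities/FrobeniusClosing`, crux #6 `PatchingRelPerfect` (one term shared by
eight routes). [OURS · L1 W5.2] This file proves the registered stub `stub_atomicRoofEngine` of
skeleton v4 of the line `closed-point-slice`, verbatim: for ANY field `k`, an integral separated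
`k`-scheme of finite type `M` every point `m` of which has a REGULAR ROOF — a proper birational
`k`-morphism `q : M → N` onto an integral finite-type `k`-scheme with `𝒪_{N,q m}` regular — whose
regular local rings carry LOCAL DESINGULARIZATIONS (every integral `T`, proper and birational over
`Spec 𝒪_{N,y}` and regular off the closed fibre, admits a blowing up with centre in `Sing T` and
regular source, Temkin 2008, Def. 2.2.6) has a resolution of singularities. This is the
GLOBALISATION ("patching") half of Zariski's programme, as a theorem in every dimension; the local
half (the atoms) is what remains open in dimension `≥ 4`.

## Proof (the first two items are the prequel `…AtomicRoofEnginePhase.lean`; this file: the third)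

* `temkinStep_centre` — Temkin's step (proof of Prop. 2.3.4) over an ARBITRARY base `N` at a
  maximal point `y` of a closed `C ⊆ N` over which all singular points of `h : X₁ → N` lie: the
  local desingularization of `X₁ ×_N Spec 𝒪_{N,y}` extends (Lemma 2.1.1) to a blowing up of `X₁`
  whose CENTRE LIES IN `Sing X₁` and whose singular points lie over `C ∖ {y}`. (The landed
  `stub_roofEngineNonClosedStep` is this step; here the position of the centre is exported.)
* `roofPhase` — for ONE roof `q : M → N` with local desingularizations over `Reg N` and a proper
  birational `f : X' → M`: a blowing up `X₁ → X'` with centre in `Sing X'` after which every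
  singular point lies over `Sing N`. Well-founded induction on a closed `C ⊆ N` containing the
  images of the singular points that lie over `Reg N`; the step is taken at a maximal point of
  `C ∪ Sing N` above such an image, which is a regular point of `N` (the regular locus is open);
  the local scheme there is integral, proper, birational and regular off the closed fibre (by
  maximality), so the roof's atom applies.
* `stub_atomicRoofEngine` — finitely many roofs `q_m : M → N_m` with `⋃ q_m⁻¹(Reg N_m) = M` (`M`
  is quasi-compact, `Reg N_m` is open); induction on this finite set running one phase per roof on
  the current model (centres in `Sing`, so what is regular stays regular and singular points keep
  singular images); at the end a singular point would lie over `Sing N_m` for every `m`,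
  impossible; the composite is a blowing up of `M` along an ideal cosupported in `Sing M ∌ η_M`
  (Stacks 080B), hence a resolution.

## Sources

* M. Temkin, *Desingularization of quasi-excellent schemes in characteristic zero*, Adv. Math.
  219 (2008) 488–522 = arXiv:math/0703678: Lemma 2.1.1, Def. 2.2.6, Prop. 2.3.4 and its proof
  (p. 12, arXiv pagination). [Temkin2008]
* O. Piltant, *An axiomatic version of Zariski's patching theorem*, RACSAM 107 (2013) 91–121,
  Prop. 5.1 and Cor. 5.7 (resolving systems, regular roofs). [Piltant2013]
* O. Zariski, *Reduction of the singularities of algebraic three dimensional varieties*, Ann. of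
  Math. 45 (1944) 472–542, Fundamental Theorem p. 539. [Zariski1944]
* The Stacks Project, Tags 080A/080B (composition of blowing ups), 01J7. [StacksProject]
-/

set_option linter.dupNamespace false -- single-problem summit: doubled namespace component is forced

noncomputable section

open CategoryTheory CategoryTheory.Limits AlgebraicGeometry Literature.AlgebraicGeometry.Resolution
open TopologicalSpace IsLocalRing

namespace Summit.ResolutionOfSingularities.ResolutionOfSingularities.Theorems

/-! ## The engine -/

/-- **STUB `stub_atomicRoofEngine` (line `closed-point-slice` v4, registered signature verbatim) —
Zariski–Piltant patching in every dimension, Temkin format, any field.** An integral separated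
`k`-scheme of finite type `M` every point of which has a regular roof carrying local
desingularizations over all its regular points has a resolution of singularities. PROOF: the
opens `q_m⁻¹(Reg N_m)` cover `M` and finitely many suffice (`M` is quasi-compact, `Reg N_m` is
open); induction on this finite set of roofs, composing one `roofPhase` per roof (centres in the
singular locus of the current model, so singular points keep singular images and the composite is
a blowing up of `M` with centre in `Sing M ∌ η_M`, Stacks 080B); after the last phase a singular
point would lie over `Sing N_m` for every roof of the subcover — impossible — so the model is
regular and the composite blowing up (along a non-zero ideal: proper, birational) is a resolution.
[cite: Temkin2008, Prop. 2.3.4 (proof) and Lemma 2.1.1; Piltant2013, Prop. 5.1 and Cor. 5.7;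
Zariski1944, p. 539] -/
theorem stub_atomicRoofEngine (k : Type) [Field k] (M : Scheme.{0}) (g : M ⟶ Spec (.of k))
    [IsSeparated g] [LocallyOfFiniteType g] [QuasiCompact g] [IsIntegral M]
    (hroof : ∀ m : M, ∃ (N : Scheme.{0}) (gN : N ⟶ Spec (.of k)) (q : M ⟶ N),
      IsSeparated gN ∧ LocallyOfFiniteType gN ∧ QuasiCompact gN ∧ IsIntegral N ∧
      q ≫ gN = g ∧ IsProper q ∧ IsBirational q ∧
      IsRegularLocalRing (N.presheaf.stalk (q.base m)) ∧
      ∀ y : N, IsRegularLocalRing (N.presheaf.stalk y) →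
        ∀ (T : Scheme.{0}) (h : T ⟶ Spec (N.presheaf.stalk y)), IsIntegral T → IsProper h →
          IsBirational h →
          (∀ t : T, h.base t ≠ IsLocalRing.closedPoint (N.presheaf.stalk y) →
            IsRegularLocalRing (T.presheaf.stalk t)) →
          Scheme.AdmitsDesingularization T) :
    Scheme.HasResolution M := by
  classical
  choose N gN q hsep hloft hqc hint hcomm hprop hbir hregm hA using hroof
  haveI : IsNoetherian M := Scheme.isNoetherian_of_finiteType_over_field g
  haveI : CompactSpace M := QuasiCompact.compactSpace_of_compactSpace g
  have hk : Scheme.IsQuasiExcellent (Spec (.of k)) :=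
    Scheme.isQuasiExcellent_of_locallyOfFiniteType Stacks07QW_field_holds (𝟙 _)
  have hηM : genericPoint M ∈ Scheme.regularLocus M := genericPoint_mem_regularLocus M
  -- the open cover of `M` by the preimages of the regular loci of the roofs; a finite subcover
  have hopen : ∀ m : M, IsOpen ((q m) ⁻¹' Scheme.regularLocus (N m)) := fun m => by
    haveI := hloft m
    have hc : IsClosed (Scheme.regularLocus (N m))ᶜ :=
      isClosed_compl_regularLocus_of_locallyOfFiniteType (gN m) hk
    have ho : IsOpen (Scheme.regularLocus (N m)) := by
      rw [← compl_compl (Scheme.regularLocus (N m))]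
      exact hc.isOpen_compl
    exact ho.preimage (q m).continuous
  have hmem : ∀ m : M, m ∈ (q m) ⁻¹' Scheme.regularLocus (N m) := fun m =>
    (Scheme.mem_regularLocus _).mpr (hregm m)
  obtain ⟨t, ht⟩ := isCompact_univ.elim_finite_subcover
    (fun m : M => (q m) ⁻¹' Scheme.regularLocus (N m)) hopen
    (fun m _ => Set.mem_iUnion.mpr ⟨m, hmem m⟩)
  -- induction on the finite set of roofs: a blowing up of `M` with centre in `Sing M` whose
  -- singular points lie over `Sing N_m` for every roof `m ∈ s` processed so far
  have main : ∀ s : Finset M, ∃ (X' : Scheme.{0}) (f : X' ⟶ M) (J : M.IdealSheafData),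
      IsBlowup f J ∧ (J.support : Set M) ⊆ (Scheme.regularLocus M)ᶜ ∧
      ∀ x' : X', x' ∉ Scheme.regularLocus X' →
        ∀ m ∈ s, q m (f x') ∉ Scheme.regularLocus (N m) := by
    intro s
    induction s using Finset.induction_on with
    | empty =>
      refine ⟨M, 𝟙 M, ⊤, isBlowup_id_top M, ?_, fun x' _ m hm => ?_⟩
      · simp [Scheme.IdealSheafData.support_top]
      · simp at hm
    | insert m₀ s hm₀ ih =>
      obtain ⟨X', f, J, hf, hJ, hs⟩ := ih
      have hne : J ≠ ⊥ := by
        rintro rfl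
        have : genericPoint M ∈ ((⊥ : M.IdealSheafData).support : Set M) := by
          rw [Scheme.IdealSheafData.support_bot]; trivial
        exact hJ this hηM
      haveI : IsIntegral X' := hf.isIntegral hne
      haveI : IsProper f := hf.isProper
      have hfbir : IsBirational f := hf.isBirational' hne
      haveI := hloft m₀
      haveI := hqc m₀
      haveI := hint m₀
      haveI := hprop m₀
      -- the phase for the roof `m₀`
      obtain ⟨X₁, f₁, J₁, hf₁, hJ₁, hphase⟩ :=
        roofPhase (gN m₀) (q m₀) (hbir m₀) (hA m₀) f hfbir
      -- compose with the blowing up so far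
      obtain ⟨Q, hQ, hQsupp⟩ := hf.exists_isBlowup_comp hf₁
      have hfsing : ∀ x' : X', x' ∉ Scheme.regularLocus X' → f x' ∉ Scheme.regularLocus M :=
        fun x' hx' hreg => hx' (mem_regularLocus_of_isBlowup_of_support_subset hf hJ x' hreg)
      have hQsing : (Q.support : Set M) ⊆ (Scheme.regularLocus M)ᶜ := by
        intro x hx
        rcases hQsupp hx with hx' | ⟨x', hx', rfl⟩
        · exact hJ hx'
        · exact hfsing x' (hJ₁ hx')
      refine ⟨X₁, f₁ ≫ f, Q, hQ, hQsing, fun x₁ hx₁ m hm => ?_⟩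
      rw [Scheme.Hom.comp_apply]
      rcases Finset.mem_insert.mp hm with rfl | hm'
      · exact (hphase x₁ hx₁).2
      · exact hs (f₁ x₁) (hphase x₁ hx₁).1 m hm'
  -- after the last phase the model is regular
  obtain ⟨X', f, J, hf, hJ, hsing⟩ := main t
  have hne : J ≠ ⊥ := by
    rintro rfl
    have : genericPoint M ∈ ((⊥ : M.IdealSheafData).support : Set M) := by
      rw [Scheme.IdealSheafData.support_bot]; trivial
    exact hJ this hηM
  have hall : ∀ x' : X', x' ∈ Scheme.regularLocus X' := by
    intro x'
    by_contra hx'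
    obtain ⟨m, hm⟩ := Set.mem_iUnion.mp (ht (Set.mem_univ (f x')))
    obtain ⟨hmt, hmU⟩ := Set.mem_iUnion.mp hm
    exact hsing x' hx' m hmt hmU
  haveI : IsLocallyNoetherian M := inferInstance
  exact ⟨X', f, hf.isResolution' stacks02NS_holds hne fun x' =>
    (Scheme.mem_regularLocus x').mp (hall x')⟩

end Summit.ResolutionOfSingularities.ResolutionOfSingularities.Theorems

end
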